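import Summits.QuantumFields.BalabanUV.Beta.GAN24.FaceWordEEDeep
import Summits.QuantumFields.BalabanUV.Beta.GAN24.FaceWordNullSector
import Summits.QuantumFields.BalabanUV.Beta.GAN24.FaceWordVHNullCurrents
import Summits.QuantumFields.BalabanUV.Beta.SpineRecursiveW

/-!
# `BalabanUV.Beta.GAN24.FaceWordFullDeep` — binder row G-an2-4 ∕ (CONV-C), W-slot (α-0), typer's PART VI row **T6-VAL**, the (γ) hand's letter **K7-a WITH THE SECTOR SPLIT (α) DONE (levels
# `≥ 1`)**: **leaf-02 Part 45's OUTPUT WORD FOR road-P2's FULL UNIT-SCALED LEVEL-`(j+1)` FINE TABLE `S♮_{j+1} = unitS sf sm (SpureRecAt d Lc ρ cE cVH cΛ (j+1))` (at E's pins `cE = Lc^{d+1}`,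
# `cVH = −½Lc^{2(d+1)}`) — E AND VH SECTORS TOGETHER — THROUGH `X̃♮_{j+1}` AT THE DEEP PERIOD `Lc·N`, VALUED**: it equals g56's E-sector value `FaceWordEEDeep.faceWordEE_deep_value` with the
# amplitude `cE·wE_{j+1}` (`μ ≠ α`, `ν ≠ β`; every `j`, `d`, in-block root, `Lc, N ≥ 1`, all units, any `cΛ`) — the VH sector `(cVH·wVH_{j+1}) • vhSAt` has null two-face currents
# (`FaceWordVHNullCurrents`), so by `FaceWordNullSector.faceWord_eq_cellPairing_of_null` no mixed word is formed; the level-`0` twin is `FaceWordFullZero`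
# (G-an2-4 CRUX TEAM (2), seat `b2b-balaban-gan24-formalise-leaf-06` = the (γ) hand, gen 57; journal [GAN24LEAF06-G57-INTENT-5])

NOT IN PRINT; OUR BOOKKEEPING ([folklore] bookkeeping BY NAME: an2's `SpineRecursiveW.SpureRecAt_succ ∕ SpureRecAt_translate`, an1's `locStencil_vhSAt`, `HessKerDressedUnits.unitS_apply ∕
locStencil_unitS`, `StepJetData.locStencil_smul ∕ locStencil_add`, `BalabanStepJets.locStencil_mono`; g56's `FaceWordEEDeep` (admissibility of `S^E`, `exists_common_rate`,
`dressedStep_invariant_deep`, `cellPairing` value via `faceWordEE_deep_value`'s ingredients) and this seat's (K), (L); 0 `def`, 0 cited fact, 0 `def … : Prop`, 0 sorry).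
HONEST FRAMING (cell contract, verbatim): «discharging `BetaPertH` makes Bałaban's UV stability UNCONDITIONAL — a real constructive-QFT result; it is NOT the continuum
limit and NOT the Clay problem.»  HONEST DEPENDENCY (verbatim): «continuum YM on T⁴ ⇐ BetaPertH ∧ nine spine estimates (0/9 proved); BetaPertH ⇐ (D1) ∧ (D4) ∧ CAP+tail;
G-an2-4 gates asym, D1 and NE2/3/4.»

WHAT ([folklore]): §1 `fullTableSucc_split`, `fullTableSucc_translate`, `exists_common_rate_fullSucc`; §2 **`faceWordFull_deep_value`**.  The W word of Part 47 and the `LS`∕`FFsym`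
pattern sum remain the adapter's; asserts NO value of Bałaban's tables beyond this identity; discharges NOTHING of `hX` ∕ `hXu` ∕ (C)_{≥1} ∕ `hB0` ∕ `hBF` ∕ (Q-L); NEVER «G-an2-4 closed»
as (CONV-C); NOT D1, NOT `BetaPertH`, NOT continuum, NOT Clay.  2026-08-24; no existing file touched.
-/

noncomputable section

open Finset
open scoped BigOperators
open Literature.MathematicalPhysics.QuantumFieldTheory
open Literature.MathematicalPhysics.QuantumFieldTheory.Balaban1983to89
open Literature.MathematicalPhysics.QuantumFieldTheory.Balaban1983to89.Beta
open ExpKernelCalculus (Site MKer Decays BiLoc shiftK comp)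
open OneStepResolventKernel (Fib LocStencil decays_mono)
open OneStepKernelFamily (KInvStep)
open BalabanStepJets (locStencil_mono)
open StepJetData (locStencil_smul locStencil_add)
open AffineAveraging (box toSite)
open AveragingHessianKernelsRooted (vhSAt locStencil_vhSAt vhSAt_translate)
open BalabanStepJetsSucc (E2 wVH wE)
open Summit.QuantumFields.BalabanUV.Beta.AxialDressingRooted (coDressKBmAt one_le_of_neZero decays_coDressKBmAt_KInvStep)
open Summit.QuantumFields.BalabanUV.Beta.HessKerDressedUnits (unitK unitS unitS_apply locStencil_unitS decays_unitK)
open Summit.QuantumFields.BalabanUV.Beta.SpineRooted (SpureRecAt e3OfK SpureRecAt_succ SpureRecAt_translate)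
open Summit.QuantumFields.BalabanUV.Beta.WardLocusRecursive (SrecAt)
open Summit.QuantumFields.BalabanUV.Beta.GAN24.FaceWordNullSector (faceWord_eq_cellPairing_of_null)
open Summit.QuantumFields.BalabanUV.Beta.GAN24.FaceWordVHNullCurrents (vhSector_nullL vhSector_nullR)
open Summit.QuantumFields.BalabanUV.Beta.GAN24.FaceWordEEDeep (sectorE_inr_left sectorE_inr_right exists_common_rate dressedStep_invariant_deep)
open Summit.QuantumFields.BalabanUV.Beta.GAN24.FaceWordEEValueDeep (cellPairing_deep_value_units)

namespace Summit.QuantumFields.BalabanUV.Beta.GAN24.FaceWordFullDeep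

variable {d : ℕ} {Lc : ℕ} [NeZero Lc] {r : Fin (d + 1) → ℕ}

/-! ## §1 The level-`(j+1)` fine table splits into its E and VH sectors through the units; covariance; one common rate -/

/-- [folklore] **`S♮_{j+1} = S^E_{j+1} + S^VH_{j+1}` SLOTWISE** (`SpureRecAt_succ` through the linear units). -/
theorem fullTableSucc_split (sf sm cΛ : ℝ) (j : ℕ) (κ : Fin (d + 1)) (t : Site (d + 1)) :
    unitS sf sm (SpureRecAt d Lc (toSite r) ((Lc : ℝ) ^ (d + 1)) (-((Lc : ℝ) ^ (d + 1) * (1 / 2) * (Lc : ℝ) ^ (d + 1))) cΛ (j + 1)) κ t =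
      unitS sf sm (fun κ u => ((Lc : ℝ) ^ (d + 1) * wE d Lc (j + 1)) • e3OfK Lc (coDressKBmAt (toSite r) Lc (KInvStep (d := d) Lc j))
        (SrecAt d Lc (toSite r) ((Lc : ℝ) ^ (d + 1)) (-((Lc : ℝ) ^ (d + 1) * (1 / 2) * (Lc : ℝ) ^ (d + 1))) cΛ j) κ u) κ t +
      unitS sf sm (fun κ u => ((-((Lc : ℝ) ^ (d + 1) * (1 / 2) * (Lc : ℝ) ^ (d + 1))) * wVH d Lc (j + 1)) • vhSAt (toSite r) d Lc rfl κ u) κ t := by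
  funext x z a b
  simp only [Pi.add_apply, unitS_apply, SpureRecAt_succ, Pi.smul_apply, smul_eq_mul]
  ring

/-- [folklore] **`Lc•t`-COVARIANCE OF THE UNIT-SCALED LEVEL-`(j+1)` TABLE** (`SpureRecAt_translate` through the units). -/
theorem fullTableSucc_translate (sf sm cΛ : ℝ) (j : ℕ) (κ : Fin (d + 1)) (u t : Site (d + 1)) :
    unitS sf sm (SpureRecAt d Lc (toSite r) ((Lc : ℝ) ^ (d + 1)) (-((Lc : ℝ) ^ (d + 1) * (1 / 2) * (Lc : ℝ) ^ (d + 1))) cΛ (j + 1)) κ (u + (Lc : ℤ) • t) =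
      shiftK (-((Lc : ℤ) • t)) (unitS sf sm (SpureRecAt d Lc (toSite r) ((Lc : ℝ) ^ (d + 1)) (-((Lc : ℝ) ^ (d + 1) * (1 / 2) * (Lc : ℝ) ^ (d + 1))) cΛ (j + 1)) κ u) := by
  have hLc : 1 ≤ Lc := one_le_of_neZero Lc
  have h := SpureRecAt_translate (d := d) (toSite r) hLc ((Lc : ℝ) ^ (d + 1)) (-((Lc : ℝ) ^ (d + 1) * (1 / 2) * (Lc : ℝ) ^ (d + 1))) cΛ (j + 1) κ u t
  funext x z a b
  have hxz := congrFun (congrFun (congrFun (congrFun h x) z) a) b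
  simp only [unitS_apply, shiftK] at hxz ⊢
  rw [hxz]

/-- [folklore] **ONE COMMON RATE** for `S♮_{j+1}`, `S^E_{j+1}`, `S^VH_{j+1}` and the decaying `X̃♮_{j+1}` (g56's `exists_common_rate` for the E sector and `X̃♮`; `vhSAt` is local at every rate;
the sum by `locStencil_add`). -/
theorem exists_common_rate_fullSucc (hr : r ∈ box (d + 1) Lc) (sf sm cΛ : ℝ) (j : ℕ) :
    ∃ Cs Cs₁ Cs₂ CX m : ℝ, 0 < m ∧ LocStencil (unitS sf sm (SpureRecAt d Lc (toSite r) ((Lc : ℝ) ^ (d + 1)) (-((Lc : ℝ) ^ (d + 1) * (1 / 2) * (Lc : ℝ) ^ (d + 1))) cΛ (j + 1))) Cs m ∧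
      LocStencil (unitS sf sm (fun κ u => ((Lc : ℝ) ^ (d + 1) * wE d Lc (j + 1)) • e3OfK Lc (coDressKBmAt (toSite r) Lc (KInvStep (d := d) Lc j))
        (SrecAt d Lc (toSite r) ((Lc : ℝ) ^ (d + 1)) (-((Lc : ℝ) ^ (d + 1) * (1 / 2) * (Lc : ℝ) ^ (d + 1))) cΛ j) κ u)) Cs₁ m ∧
      LocStencil (unitS sf sm (fun κ u => ((-((Lc : ℝ) ^ (d + 1) * (1 / 2) * (Lc : ℝ) ^ (d + 1))) * wVH d Lc (j + 1)) • vhSAt (toSite r) d Lc rfl κ u)) Cs₂ m ∧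
      Decays (unitK sf sm (coDressKBmAt (toSite r) Lc (KInvStep (d := d) Lc (j + 1)))) CX m := by
  have hLc : 1 ≤ Lc := one_le_of_neZero Lc
  obtain ⟨Cs₁, CX, m, hm, hS₁, hX⟩ := exists_common_rate (d := d) hr sf sm ((Lc : ℝ) ^ (d + 1) * wE d Lc (j + 1)) cΛ j
  have hV := locStencil_vhSAt (d := d) hLc hr hm.le
  have hS₂ := locStencil_unitS (sf := sf) (sm := sm) (locStencil_smul ((-((Lc : ℝ) ^ (d + 1) * (1 / 2) * (Lc : ℝ) ^ (d + 1))) * wVH d Lc (j + 1)) hV)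
  have hsum := locStencil_add hS₁ hS₂
  have e : (unitS sf sm (SpureRecAt d Lc (toSite r) ((Lc : ℝ) ^ (d + 1)) (-((Lc : ℝ) ^ (d + 1) * (1 / 2) * (Lc : ℝ) ^ (d + 1))) cΛ (j + 1))) =
      fun κ t => unitS sf sm (fun κ u => ((Lc : ℝ) ^ (d + 1) * wE d Lc (j + 1)) • e3OfK Lc (coDressKBmAt (toSite r) Lc (KInvStep (d := d) Lc j))
      (SrecAt d Lc (toSite r) ((Lc : ℝ) ^ (d + 1)) (-((Lc : ℝ) ^ (d + 1) * (1 / 2) * (Lc : ℝ) ^ (d + 1))) cΛ j) κ u) κ t +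
        unitS sf sm (fun κ u => ((-((Lc : ℝ) ^ (d + 1) * (1 / 2) * (Lc : ℝ) ^ (d + 1))) * wVH d Lc (j + 1)) • vhSAt (toSite r) d Lc rfl κ u) κ t := by
    funext κ t
    exact fullTableSucc_split (r := r) sf sm cΛ j κ t
  obtain ⟨Cs, hS⟩ : ∃ C : ℝ, LocStencil (unitS sf sm (SpureRecAt d Lc (toSite r) ((Lc : ℝ) ^ (d + 1)) (-((Lc : ℝ) ^ (d + 1) * (1 / 2) * (Lc : ℝ) ^ (d + 1))) cΛ (j + 1))) C m :=
    ⟨_, by rw [e]; exact hsum⟩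
  exact ⟨Cs, _, _, _, m, hm, hS, hS₁, hS₂, hX⟩

/-! ## §2 The face word of the FULL level-`(j+1)` table at the deep period, valued -/

/-- NOT IN PRINT; OUR BOOKKEEPING.  **leaf-02 PART 45's OUTPUT WORD FOR THE FULL LEVEL-`(j+1)` FINE TABLE AT PERIOD `Lc·N`, VALUED** (module docstring; `μ ≠ α`, `ν ≠ β`): the VH sector
contributes nothing, the E sector its `FaceWordEEValueDeep` value with the amplitude `Lc^{d+1}·wE_{j+1}`. -/
theorem faceWordFull_deep_value (hr : r ∈ box (d + 1) Lc) (sf sm cΛ : ℝ) (j N : ℕ) [NeZero N] {μ α ν β : Fin (d + 1)} (hμα : μ ≠ α) (hνβ : ν ≠ β) :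
    ∑ rr ∈ box (d + 1) (Lc * N), ∑' t : Site (d + 1),
        (if toSite rr μ % ((Lc * N : ℕ) : ℤ) = ((Lc * N : ℕ) : ℤ) - 1 then (1 : ℝ) else 0) * (if t ν % ((Lc * N : ℕ) : ℤ) = ((Lc * N : ℕ) : ℤ) - 1 then (1 : ℝ) else 0) *
        ∑' yw : Site (d + 1) × Site (d + 1),
          (if yw.1 α % ((Lc * N : ℕ) : ℤ) = ((Lc * N : ℕ) : ℤ) - 1 then (1 : ℝ) else 0) * (if yw.2 β % ((Lc * N : ℕ) : ℤ) = ((Lc * N : ℕ) : ℤ) - 1 then (1 : ℝ) else 0) *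
          comp (comp (unitS sf sm (SpureRecAt d Lc (toSite r) ((Lc : ℝ) ^ (d + 1)) (-((Lc : ℝ) ^ (d + 1) * (1 / 2) * (Lc : ℝ) ^ (d + 1))) cΛ (j + 1)) μ (toSite rr))
            (unitK sf sm (coDressKBmAt (toSite r) Lc (KInvStep (d := d) Lc (j + 1)))))
            (unitS sf sm (SpureRecAt d Lc (toSite r) ((Lc : ℝ) ^ (d + 1)) (-((Lc : ℝ) ^ (d + 1) * (1 / 2) * (Lc : ℝ) ^ (d + 1))) cΛ (j + 1)) ν t)
            yw.1 yw.2 (Sum.inl α) (Sum.inl β) =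
      (((sf * sm)⁻¹ * (sf⁻¹ * sf⁻¹) * ((Lc : ℝ) ^ (d + 1) * wE d Lc (j + 1))) * ((sf * sm)⁻¹ * (sf⁻¹ * sf⁻¹) * ((Lc : ℝ) ^ (d + 1) * wE d Lc (j + 1)))) *
      ((-(1 / 2 : ℝ)) * (1 / 2 : ℝ) * ((sf * sf) *
        ((wVH d Lc (j + 1))⁻¹ *
            ∑ x ∈ box (d + 1) (Lc * N), ∑ b : Fin (d + 1),
              ((if b = μ then ((((Lc * N : ℕ) : ℝ))⁻¹ * (((Lc * N : ℕ) : ℝ))⁻¹) * ((((toSite x α % ((Lc * N : ℕ) : ℤ) : ℤ) : ℝ) - ((((Lc * N : ℕ) : ℝ)) - 1) / 2)) else 0)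
                + (if b = α then (-(((Lc * N : ℕ) : ℝ))⁻¹ * ((((toSite x μ % ((Lc * N : ℕ) : ℤ) : ℤ) : ℝ) - ((((Lc * N : ℕ) : ℝ)) - 1) / 2))) *
                    (if toSite x α % ((Lc * N : ℕ) : ℤ) = ((Lc * N : ℕ) : ℤ) - 1 then (1 : ℝ) else 0) else 0)) *
              ∑' s : Site (d + 1), ∑ b' : Fin (d + 1), E2 d Lc (j + 1) (toSite x) s (Sum.inl b) (Sum.inl b') *
                ((if b' = ν then ((((Lc * N : ℕ) : ℝ))⁻¹ * (((Lc * N : ℕ) : ℝ))⁻¹) * ((((s β % ((Lc * N : ℕ) : ℤ) : ℤ) : ℝ) - ((((Lc * N : ℕ) : ℝ)) - 1) / 2)) else 0)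
                  + (if b' = β then (-(((Lc * N : ℕ) : ℝ))⁻¹ * ((((s ν % ((Lc * N : ℕ) : ℤ) : ℤ) : ℝ) - ((((Lc * N : ℕ) : ℝ)) - 1) / 2))) *
                      (if s β % ((Lc * N : ℕ) : ℤ) = ((Lc * N : ℕ) : ℤ) - 1 then (1 : ℝ) else 0) else 0)) -
          (wVH d Lc (j + 1))⁻¹ * (((Lc : ℝ) ^ (d + 1) * (Lc : ℝ) ^ (d + 1)) *
            ∑ y ∈ box (d + 1) N, ∑ a : Fin (d + 1),
              ((if a = μ then (((N : ℝ))⁻¹ * ((N : ℝ))⁻¹) * ((((toSite y α % (N : ℤ)) : ℤ) : ℝ) - ((N : ℝ) - 1) / 2) else 0)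
                + (if a = α then (-((N : ℝ))⁻¹ * ((((toSite y μ % (N : ℤ)) : ℤ) : ℝ) - ((N : ℝ) - 1) / 2)) *
                    (if toSite y α % (N : ℤ) = (N : ℤ) - 1 then (1 : ℝ) else 0) else 0)) *
              ∑' s : Site (d + 1), ∑ b' : Fin (d + 1), E2 d Lc (j + 2) (toSite y) s (Sum.inl a) (Sum.inl b') *
                ((if b' = ν then (((N : ℝ))⁻¹ * ((N : ℝ))⁻¹) * ((((s β % (N : ℤ)) : ℤ) : ℝ) - ((N : ℝ) - 1) / 2) else 0)
                  + (if b' = β then (-((N : ℝ))⁻¹ * ((((s ν % (N : ℤ)) : ℤ) : ℝ) - ((N : ℝ) - 1) / 2)) *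
                      (if s β % (N : ℤ) = (N : ℤ) - 1 then (1 : ℝ) else 0) else 0)))))) := by
  have hLc : 1 ≤ Lc := one_le_of_neZero Lc
  haveI : NeZero (Lc * N) := ⟨Nat.mul_ne_zero (NeZero.ne Lc) (NeZero.ne N)⟩
  obtain ⟨Cs, Cs₁, Cs₂, CX, m, hm, hS, hS₁, hS₂, hX⟩ := exists_common_rate_fullSucc (d := d) hr sf sm cΛ j
  rw [faceWord_eq_cellPairing_of_null (N := Lc * N) hS hS₁ hS₂ hX hm
      (fun κ t s => by
        have h := fullTableSucc_translate (Lc := Lc) (r := r) sf sm cΛ j κ t ((N : ℤ) • s)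
        rwa [smul_smul, ← Nat.cast_mul] at h)
      (fun s => dressedStep_invariant_deep (Lc := Lc) (r := r) sf sm j N s)
      (fun κ t => fullTableSucc_split (Lc := Lc) (r := r) sf sm cΛ j κ t)
      (fun κ t y x m' b => sectorE_inr_left (Lc := Lc) (r := r) sf sm ((Lc : ℝ) ^ (d + 1) * wE d Lc (j + 1)) cΛ j κ t y x m' b)
      (fun κ t y x a m' => sectorE_inr_right (Lc := Lc) (r := r) sf sm ((Lc : ℝ) ^ (d + 1) * wE d Lc (j + 1)) cΛ j κ t y x a m') μ ν α β
      (fun x f => vhSector_nullL (d := d) hLc hr N sf sm ((-((Lc : ℝ) ^ (d + 1) * (1 / 2) * (Lc : ℝ) ^ (d + 1))) * wVH d Lc (j + 1)) μ α x f)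
      (fun z g => vhSector_nullR (d := d) hLc hr N sf sm ((-((Lc : ℝ) ^ (d + 1) * (1 / 2) * (Lc : ℝ) ^ (d + 1))) * wVH d Lc (j + 1)) ν β z g)]
  exact cellPairing_deep_value_units hr sf sm ((Lc : ℝ) ^ (d + 1) * wE d Lc (j + 1)) cΛ j N hμα hνβ

end Summit.QuantumFields.BalabanUV.Beta.GAN24.FaceWordFullDeep

end
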